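import Literature.MathematicalPhysics.QuantumFieldTheory.Balaban1983to89.B11Ineq73KernelLettersUniform

/-!
# `Balaban1983to89.B11Eq80CurrentTwoCarriers` — T. Bałaban, *The variational problem and background fields in renormalization group method for lattice gauge theories*, Commun. Math. Phys. **102** (1985) 277–309 [Balaban1985Variational]: (84)–(90) p. 290–291 with (115) p. 294 and Prop. 6 (117) p. 295 — THE GROUPS OF `W(A′) = (δ/δA′)V(A′)` READ ACROSS TWO CARRIERS (115): the transposes `𝔇*(A′)H*` of (85)–(90) at a derivative letter `∇₁` compared with the same objects at `∇₂` through the identity of the underlying configurations, and the four groups `W₁, W₂, W₃`, the composed V₀-group bounded group by group by the defects of their letters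

statement-level skeleton of published theorems with citation tags; proofs where landed; nothing here is a claim about the Yang–Mills mass gap

PDF held: `paper:balaban1985-cmp102-variational-background` (journal page = PDF page + 276); pp. 290–295 read on the text layer by this lineage
(displays transcribed in `B11Eq80Current` ((80), (84)–(90)), `B11Eq115Space` ((115)), `B11Eq120SolutionContinuity` ((117)–(121))).

CITATION HEADER (lean-in-tree rule 2026-08-18).  WHAT IS REPRODUCED: nothing of print is asserted.  Print compares the objects of Sect. E at two
configurations through (117)/(119)–(120) p. 295 (*«A difference of its values at configurations A₁, A₂ can be written as …»*) and treats the
background dependence of the operators by [Balaban1985BackgroundPropagators] Thm 3.4 p. 400 (*«analytic functions of A»*).  The pub-balaban NE9 chain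
reads the chart of the species `cur U` at a background `U` AND at the flat background `1`; the two configuration spaces (115) differ through the
derivative letter `∇_U` (`Space115 L η lev₀ lev₁ (nabla115 η U)`), and the W-slot of the chart is this lineage's `W80` (`B11Eq80Current`).  The
OWNER's `NE9CurChartLipschitzAtFlat` DISPLAYS the resulting modulus `‖W_U P − W_1(ιP)‖ ≤ δ_W`; this file is the [folklore] bookkeeping that reduces
it, GROUP BY GROUP, to defects of the letters — all at two abstract derivative letters `Dc₁, Dc₂` of ONE lattice, `ι = ι_{Dc₁→Dc₂}` the jet identity
written as the explicit term of `B11Eq117LetterDefects` §1.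

WHAT IS PROVED (sorry-free; axioms standard; 0 def; [folklore] throughout).
§1 TRANSPORT: `curV0_jetId` (the V₀-current of `ιY` at carrier 2 IS that of `Y` at carrier 1, `rfl`), `kernel (ι ∘L M ∘L ι⁻¹) = kernel M`, **`transCur_conj`** `transCur ρ τ (ι ∘L M ∘L ι⁻¹) K = transCur ρ τ M K` — the transpose (85)–(90)
   sees an operator of the space (115) only through its kernel `flat115 ∘ M ∘ single115`, which `ι` does not change (`rfl` on the underlying functions).
§2 `norm_transCur_le_of_colConst`, `transCur_sub_transCur`, **`norm_transCur_sub_transCur_le`** — `‖MᵗK − M′ᵗK′‖₍₋₃₎ ≤ ‖ρ‖‖τ‖κ·(‖M − M′‖·‖K‖ +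
   ‖M′‖·‖K − K′‖)` given a column constant `κ` of the carrier (`Σ_{b′}(w₃(b)/w₃(b′))‖k_N(b′, b)‖ ≤ κ‖N‖`, leaf-01's `colSum_kernel_le`).
§3 CALCULUS: `hasFDerivAt_conj` (`D(ι ∘ F ∘ ι⁻¹)(ιP) = ι ∘L DF(P) ∘L ι⁻¹`), `differentiableOn_conj_sub`, **`norm_conj_fderiv_sub_le`** — if the
   conjugated difference `G = ι ∘ F₁ ∘ ι⁻¹ − F₂` is holomorphic on `‖Q‖ < S` with `‖G‖ ≤ δ` there, then `‖ι ∘L DF₁(P) ∘L ι⁻¹ − DF₂(ιP)‖ ≤ δ/(S − ‖ιP‖)`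
   (Cauchy, `B8SectDSource.norm_fderiv_le_of_norm_le`); **`norm_sub_le_of_quad_entire`** — an entire map with `‖V Y‖ ≤ C_V‖Y‖²` on `‖Y‖ < R_V` is
   `2C_VR_V`-Lipschitz on `‖Y‖ < R_V/2` (Cauchy + the mean-value inequality on the convex ball).
§4 THE FOUR GROUPS AT A POINT, carrier 1's transposes moved to carrier 2 by §1: **`norm_W1_sub_W1_le`**, **`norm_W2_sub_W2_le`**, **`norm_W3_sub_W3_le`**,
   **`norm_curV0full_sub_curV0full_le`** — each difference `W_k(…₁) P − W_k(…₂)(ιP)` bounded by the operator defects `‖ι ∘L D(E)₁(P) ∘L ι⁻¹ − D(E)₂(ιP)‖`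
   (`E ∈ {HD, HD₃, T}`), the value defects of `HD`, `Δ_π`, `curV0` at the relevant points, and the letters' sizes — pure (85)–(90) algebra + §2.
The assembly with the radii, the Cauchy estimates and ONE constant before the data is `B11Eq98W80BackgroundModulus` (next file of this lineage).

HONEST SCOPE — what is NOT claimed.  (i) Nothing of [Balaban1985Variational] Prop. 4 ∕ (98) or of [Balaban1985BackgroundPropagators] Thm 3.4 is proved; the
column constant `κ` is a finite-lattice number (leaf-01's double bond sum, NO decay — NOT print's lattice-uniform O(1) of (73)/(86)).  (ii) The defects are
LETTERS here.  (iii) NOT summit progress (cell pub-balaban: NE9 NOT PRINTED ∕ NOT PROVED; «NE9 ⇐ the named binders»; spine PROVED 0/9; HONEST DEPENDENCY: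
continuum YM on T⁴ ⇐ BetaPertH ∧ nine spine estimates (0/9 proved); BetaPertH ⇐ (D1) ∧ (D4) ∧ CAP+tail; G-an2-4 gates asym, D1 and NE2/3/4).  Unit
`b2b-balaban-t4-ne9-formalise-leaf-05` (NE9 crux-team leaf prover, gen 70).  Imports `B11Ineq73KernelLettersUniform` ONLY; modifies nothing.
-/

noncomputable section

open Metric Set Filter Topology

namespace Literature.MathematicalPhysics.QuantumFieldTheory.Balaban1983to89.B11Eq80CurrentTwoCarriers

open Literature.MathematicalPhysics.QuantumFieldTheory.Balaban1983to89.B11Prop6Scheme (Prop4Hyp)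
open Literature.MathematicalPhysics.QuantumFieldTheory.Balaban1983to89.B11Eq174Chart (solA Regime)
open Literature.MathematicalPhysics.QuantumFieldTheory.Balaban1983to89.B11Eq90V0primeCurrent (flat115 flat115_apply)
open Literature.MathematicalPhysics.QuantumFieldTheory.Balaban1983to89.B11Eq90Transpose
open Literature.MathematicalPhysics.QuantumFieldTheory.Balaban1983to89.B11Eq90Pullback (pullCur)
open Literature.MathematicalPhysics.QuantumFieldTheory.Balaban1983to89.B11Eq90V0GroupComposed (T47 curV0full curV0full_apply)
open Literature.MathematicalPhysics.QuantumFieldTheory.Balaban1983to89.B11Eq63V0GroupCurrent (curV0)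
open Literature.MathematicalPhysics.QuantumFieldTheory.Balaban1983to89.B11Eq80Current (Emap E3 W1 W2 W3 W80)
open Literature.MathematicalPhysics.QuantumFieldTheory.Balaban1983to89.B11Eq111FrakG (jetLinearEquiv)
open B9SectCLatticeCarrier (Bond)
open B11Eq115Space

variable {𝔸 : Type*} [NormedRing 𝔸] [NormedAlgebra ℂ 𝔸] [FiniteDimensional ℂ 𝔸]
variable {d : ℕ} {Pd : Fin d → ℕ} {L η : ℝ} [Fact (0 < L)] [Fact (0 < η)] {lev₀ : Bond d Pd → ℕ} {κ' : Type*} [Fintype κ']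
  {lev₁ : κ' → ℕ} {Dc₁ Dc₂ : (Bond d Pd → 𝔸) →ₗ[ℂ] (κ' → 𝔸)}
variable {𝒳 : Type*} [NormedAddCommGroup 𝒳] [NormedSpace ℂ 𝒳]

/-! ## §1 Transport of the transpose across the two carriers -/

section Transport

/-- `ι⁻¹(ιP) = P` — the two jet identities are mutually inverse (definitionally: both are the identity of the underlying functions).
[cite: Balaban1985Variational, (115) p.294] -/
theorem jetId_symm_apply (P : Space115 L η lev₀ lev₁ Dc₁) : (LinearMap.toContinuousLinearMap ((jetLinearEquiv L η lev₀ lev₁ Dc₁).symm.toLinearMap ∘ₗ (jetLinearEquiv L η lev₀ lev₁ Dc₂).toLinearMap)) ((LinearMap.toContinuousLinearMap ((jetLinearEquiv L η lev₀ lev₁ Dc₂).symm.toLinearMap ∘ₗ (jetLinearEquiv L η lev₀ lev₁ Dc₁).toLinearMap)) P) = P := rfl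

/-- `ι ∘L ι⁻¹ = 1`. [cite: Balaban1985Variational, (115) p.294] -/
theorem jetId_comp_symm :
    (LinearMap.toContinuousLinearMap ((jetLinearEquiv L η lev₀ lev₁ Dc₂).symm.toLinearMap ∘ₗ (jetLinearEquiv L η lev₀ lev₁ Dc₁).toLinearMap)).comp (LinearMap.toContinuousLinearMap ((jetLinearEquiv L η lev₀ lev₁ Dc₁).symm.toLinearMap ∘ₗ (jetLinearEquiv L η lev₀ lev₁ Dc₂).toLinearMap)) = ContinuousLinearMap.id ℂ (Space115 L η lev₀ lev₁ Dc₂) :=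
  ContinuousLinearMap.ext fun _ => rfl

/-- `ι` does not change the underlying bond function. [cite: Balaban1985Variational, (115) p.294] -/
theorem flat115_jetId (P : Space115 L η lev₀ lev₁ Dc₁) :
    flat115 ((LinearMap.toContinuousLinearMap ((jetLinearEquiv L η lev₀ lev₁ Dc₂).symm.toLinearMap ∘ₗ (jetLinearEquiv L η lev₀ lev₁ Dc₁).toLinearMap)) P) = flat115 (L := L) (η := η) (lev₀ := lev₀) (lev₁ := lev₁) (Dc := Dc₁) P := rfl

/-- **The V₀-group current does not see the derivative letter**: `curV0` read at the second carrier of `ιY` IS `curV0` read at the first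
carrier of `Y` (the current (90)–(96) depends on `Y` only through its bond function `flat115 Y = flat115 (ιY)`), so a background modulus
`‖curV0 … U₁ Y − curV0 … U₂ (ιY)‖ ≤ δ_V` is a ONE-carrier statement — pure background dependence. [cite: Balaban1985Variational, (90)–(96) pp.291–292] -/
theorem curV0_jetId (ρ : (𝔸 →L[ℂ] ℂ) →L[ℂ] 𝔸) (τ : 𝔸 →L[ℂ] ℂ) (U₀ : Bond d Pd → 𝔸ˣ) (Y : Space115 L η lev₀ lev₁ Dc₁) :
    curV0 (lev₁ := lev₁) (Dc := Dc₂) ρ τ U₀ ((LinearMap.toContinuousLinearMap ((jetLinearEquiv L η lev₀ lev₁ Dc₂).symm.toLinearMap ∘ₗ (jetLinearEquiv L η lev₀ lev₁ Dc₁).toLinearMap)) Y) = curV0 (lev₁ := lev₁) (Dc := Dc₁) ρ τ U₀ Y := rfl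

/-- **The kernel of a conjugated operator is the kernel**: `k_{ιMι⁻¹}(b′, b) = k_M(b′, b)` (`flat115 ∘ ι = flat115`, `ι⁻¹ ∘ δ_b = δ_b`).
[cite: Balaban1985Variational, (85) p.291, (115) p.294] -/
theorem kernel_conj (M : Space115 L η lev₀ lev₁ Dc₁ →L[ℂ] Space115 L η lev₀ lev₁ Dc₁) (b' b : Bond d Pd) :
    kernel ((LinearMap.toContinuousLinearMap ((jetLinearEquiv L η lev₀ lev₁ Dc₂).symm.toLinearMap ∘ₗ (jetLinearEquiv L η lev₀ lev₁ Dc₁).toLinearMap)).comp (M.comp (LinearMap.toContinuousLinearMap ((jetLinearEquiv L η lev₀ lev₁ Dc₁).symm.toLinearMap ∘ₗ (jetLinearEquiv L η lev₀ lev₁ Dc₂).toLinearMap)))) b' b = kernel M b' b :=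
  ContinuousLinearMap.ext fun _ => rfl

/-- **TRANSPORT OF THE TRANSPOSE**: `(ιMι⁻¹)ᵗK = MᵗK` — the transpose (85)–(90) with respect to the pairing (27) depends on the operator only through
its kernel, which the change of (115)-norm does not see. [cite: Balaban1985Variational, (85) p.291, (90) p.291] -/
theorem transCur_conj (ρ : (𝔸 →L[ℂ] ℂ) →L[ℂ] 𝔸) (τ : 𝔸 →L[ℂ] ℂ) (M : Space115 L η lev₀ lev₁ Dc₁ →L[ℂ] Space115 L η lev₀ lev₁ Dc₁)
    (K : NegSize L η lev₀ 3 𝔸) :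
    transCur ρ τ ((LinearMap.toContinuousLinearMap ((jetLinearEquiv L η lev₀ lev₁ Dc₂).symm.toLinearMap ∘ₗ (jetLinearEquiv L η lev₀ lev₁ Dc₁).toLinearMap)).comp (M.comp (LinearMap.toContinuousLinearMap ((jetLinearEquiv L η lev₀ lev₁ Dc₁).symm.toLinearMap ∘ₗ (jetLinearEquiv L η lev₀ lev₁ Dc₂).toLinearMap)))) K = transCur ρ τ M K := by
  apply (NegSup.equiv (levWeight L η lev₀ 3) 𝔸).injective
  funext b
  simp only [transCur_apply, colFun, kernel_conj]

end Transport

/-! ## §2 The transpose is Lipschitz in the operator and in the current, through a column constant of the carrier -/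

section Lipschitz

variable {Dc : (Bond d Pd → 𝔸) →ₗ[ℂ] (κ' → 𝔸)}

/-- `‖NᵗK‖₍₋₃₎ ≤ ‖ρ‖‖τ‖·(κ‖N‖)·‖K‖₍₋₃₎` when every weighted kernel column of the carrier is `≤ κ·(operator norm)` (leaf-01's `colSum_kernel_le` gives
such a `κ` per lattice). [cite: Balaban1985Variational, (86) p.291] -/
theorem norm_transCur_le_of_colConst (ρ : (𝔸 →L[ℂ] ℂ) →L[ℂ] 𝔸) (τ : 𝔸 →L[ℂ] ℂ) {κc : ℝ} (hκ0 : 0 ≤ κc)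
    (hκ : ∀ (N : Space115 L η lev₀ lev₁ Dc →L[ℂ] Space115 L η lev₀ lev₁ Dc) (b : Bond d Pd),
      ∑ b' : Bond d Pd, levWeight L η lev₀ 3 b / levWeight L η lev₀ 3 b' * ‖kernel N b' b‖ ≤ κc * ‖N‖)
    (N : Space115 L η lev₀ lev₁ Dc →L[ℂ] Space115 L η lev₀ lev₁ Dc) (K : NegSize L η lev₀ 3 𝔸) :
    ‖transCur ρ τ N K‖ ≤ ‖ρ‖ * ‖τ‖ * (κc * ‖N‖) * ‖K‖ :=
  norm_transCur_le ρ τ N (by positivity) (hκ N) K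

omit [Fact (0 < L)] [Fact (0 < η)] in
/-- `MᵗK − M′ᵗK′ = (M − M′)ᵗK + M′ᵗ(K − K′)` (bilinearity of the transposition). [cite: Balaban1985Variational, (85) p.291] -/
theorem transCur_sub_transCur [Fact (0 < L)] [Fact (0 < η)] (ρ : (𝔸 →L[ℂ] ℂ) →L[ℂ] 𝔸) (τ : 𝔸 →L[ℂ] ℂ)
    (M M' : Space115 L η lev₀ lev₁ Dc →L[ℂ] Space115 L η lev₀ lev₁ Dc) (K K' : NegSize L η lev₀ 3 𝔸) :
    transCur ρ τ M K - transCur ρ τ M' K' = transCur ρ τ (M - M') K + transCur ρ τ M' (K - K') := by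
  have h1 : transCur ρ τ (M - M') K = transCur ρ τ M K - transCur ρ τ M' K := by
    show transCurL ρ τ (M - M') K = transCurL ρ τ M K - transCurL ρ τ M' K
    rw [map_sub]; rfl
  rw [h1, map_sub]; abel

/-- **`‖MᵗK − M′ᵗK′‖₍₋₃₎ ≤ ‖ρ‖‖τ‖κ·(n_M·n_K + n_{M′}·n_{KK′})`** for `‖M − M′‖ ≤ n_M`, `‖M′‖ ≤ n_{M′}`, `‖K‖ ≤ n_K`, `‖K − K′‖ ≤ n_{KK′}`.
[cite: Balaban1985Variational, (85)–(86) p.291] -/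
theorem norm_transCur_sub_transCur_le (ρ : (𝔸 →L[ℂ] ℂ) →L[ℂ] 𝔸) (τ : 𝔸 →L[ℂ] ℂ) {κc : ℝ} (hκ0 : 0 ≤ κc)
    (hκ : ∀ (N : Space115 L η lev₀ lev₁ Dc →L[ℂ] Space115 L η lev₀ lev₁ Dc) (b : Bond d Pd),
      ∑ b' : Bond d Pd, levWeight L η lev₀ 3 b / levWeight L η lev₀ 3 b' * ‖kernel N b' b‖ ≤ κc * ‖N‖)
    (M M' : Space115 L η lev₀ lev₁ Dc →L[ℂ] Space115 L η lev₀ lev₁ Dc) (K K' : NegSize L η lev₀ 3 𝔸) {nM nM' nK nKK' : ℝ}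
    (hM : ‖M - M'‖ ≤ nM) (hM' : ‖M'‖ ≤ nM') (hK : ‖K‖ ≤ nK) (hKK' : ‖K - K'‖ ≤ nKK') :
    ‖transCur ρ τ M K - transCur ρ τ M' K'‖ ≤ ‖ρ‖ * ‖τ‖ * κc * (nM * nK + nM' * nKK') := by
  rw [transCur_sub_transCur]
  refine (norm_add_le _ _).trans ?_
  have h1 := norm_transCur_le_of_colConst ρ τ hκ0 hκ (M - M') K
  have h2 := norm_transCur_le_of_colConst ρ τ hκ0 hκ M' (K - K')
  have hnM : 0 ≤ nM := (norm_nonneg _).trans hM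
  have hnM' : 0 ≤ nM' := (norm_nonneg _).trans hM'
  have i1 : ‖M - M'‖ * ‖K‖ ≤ nM * nK := mul_le_mul hM hK (norm_nonneg _) hnM
  have i2 : ‖M'‖ * ‖K - K'‖ ≤ nM' * nKK' := mul_le_mul hM' hKK' (norm_nonneg _) hnM'
  have hc : 0 ≤ ‖ρ‖ * ‖τ‖ * κc := by positivity
  calc ‖transCur ρ τ (M - M') K‖ + ‖transCur ρ τ M' (K - K')‖
      ≤ ‖ρ‖ * ‖τ‖ * (κc * ‖M - M'‖) * ‖K‖ + ‖ρ‖ * ‖τ‖ * (κc * ‖M'‖) * ‖K - K'‖ := add_le_add h1 h2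
    _ = ‖ρ‖ * ‖τ‖ * κc * (‖M - M'‖ * ‖K‖ + ‖M'‖ * ‖K - K'‖) := by ring
    _ ≤ ‖ρ‖ * ‖τ‖ * κc * (nM * nK + nM' * nKK') := mul_le_mul_of_nonneg_left (add_le_add i1 i2) hc

end Lipschitz

/-! ## §3 Calculus across the two carriers: the derivative of a conjugated map and Cauchy's estimate for a conjugated difference -/

section Calculus

/-- **`D(ι ∘ F ∘ ι⁻¹)(ιP) = ι ∘L DF(P) ∘L ι⁻¹`** (chain rule; `ι⁻¹(ιP) = P`). [folklore] [cite: Balaban1985Variational, Prop. 6 (117) p.295] -/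
theorem hasFDerivAt_conj {F : Space115 L η lev₀ lev₁ Dc₁ → Space115 L η lev₀ lev₁ Dc₁}
    {F' : Space115 L η lev₀ lev₁ Dc₁ →L[ℂ] Space115 L η lev₀ lev₁ Dc₁} {P : Space115 L η lev₀ lev₁ Dc₁} (hF : HasFDerivAt F F' P) :
    HasFDerivAt (fun Q : Space115 L η lev₀ lev₁ Dc₂ => (LinearMap.toContinuousLinearMap ((jetLinearEquiv L η lev₀ lev₁ Dc₂).symm.toLinearMap ∘ₗ (jetLinearEquiv L η lev₀ lev₁ Dc₁).toLinearMap)) (F ((LinearMap.toContinuousLinearMap ((jetLinearEquiv L η lev₀ lev₁ Dc₁).symm.toLinearMap ∘ₗ (jetLinearEquiv L η lev₀ lev₁ Dc₂).toLinearMap)) Q))) ((LinearMap.toContinuousLinearMap ((jetLinearEquiv L η lev₀ lev₁ Dc₂).symm.toLinearMap ∘ₗ (jetLinearEquiv L η lev₀ lev₁ Dc₁).toLinearMap)).comp (F'.comp (LinearMap.toContinuousLinearMap ((jetLinearEquiv L η lev₀ lev₁ Dc₁).symm.toLinearMap ∘ₗ (jetLinearEquiv L η lev₀ lev₁ Dc₂).toLinearMap))))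 ((LinearMap.toContinuousLinearMap ((jetLinearEquiv L η lev₀ lev₁ Dc₂).symm.toLinearMap ∘ₗ (jetLinearEquiv L η lev₀ lev₁ Dc₁).toLinearMap)) P) := by
  have h1 : HasFDerivAt (fun Q : Space115 L η lev₀ lev₁ Dc₂ => (LinearMap.toContinuousLinearMap ((jetLinearEquiv L η lev₀ lev₁ Dc₁).symm.toLinearMap ∘ₗ (jetLinearEquiv L η lev₀ lev₁ Dc₂).toLinearMap)) Q) (LinearMap.toContinuousLinearMap ((jetLinearEquiv L η lev₀ lev₁ Dc₁).symm.toLinearMap ∘ₗ (jetLinearEquiv L η lev₀ lev₁ Dc₂).toLinearMap)) ((LinearMap.toContinuousLinearMap ((jetLinearEquiv L η lev₀ lev₁ Dc₂).symm.toLinearMap ∘ₗ (jetLinearEquiv L η lev₀ lev₁ Dc₁).toLinearMap)) P) := (LinearMap.toContinuousLinearMap ((jetLinearEquiv L η lev₀ lev₁ Dc₁).symm.toLinearMap ∘ₗ (jetLinearEquiv L η lev₀ lev₁ Dc₂).toLinearMap)).hasFDerivAt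
  have h2 : HasFDerivAt F F' ((fun Q : Space115 L η lev₀ lev₁ Dc₂ => (LinearMap.toContinuousLinearMap ((jetLinearEquiv L η lev₀ lev₁ Dc₁).symm.toLinearMap ∘ₗ (jetLinearEquiv L η lev₀ lev₁ Dc₂).toLinearMap)) Q) ((LinearMap.toContinuousLinearMap ((jetLinearEquiv L η lev₀ lev₁ Dc₂).symm.toLinearMap ∘ₗ (jetLinearEquiv L η lev₀ lev₁ Dc₁).toLinearMap)) P)) := hF
  exact (LinearMap.toContinuousLinearMap ((jetLinearEquiv L η lev₀ lev₁ Dc₂).symm.toLinearMap ∘ₗ (jetLinearEquiv L η lev₀ lev₁ Dc₁).toLinearMap)).hasFDerivAt.comp ((LinearMap.toContinuousLinearMap ((jetLinearEquiv L η lev₀ lev₁ Dc₂).symm.toLinearMap ∘ₗ (jetLinearEquiv L η lev₀ lev₁ Dc₁).toLinearMap)) P) (h2.comp ((LinearMap.toContinuousLinearMap ((jetLinearEquiv L η lev₀ lev₁ Dc₂).symm.toLinearMap ∘ₗ (jetLinearEquiv L η lev₀ lev₁ Dc₁).toLinearMap)) P) h1)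

/-- The conjugated difference `Q ↦ ι(F₁(ι⁻¹Q)) − F₂(Q)` has derivative `ι ∘L DF₁(P) ∘L ι⁻¹ − DF₂(ιP)` at `ιP`. [folklore]
[cite: Balaban1985Variational, Prop. 6 (117)–(119) p.295] -/
theorem hasFDerivAt_conj_sub {F₁ : Space115 L η lev₀ lev₁ Dc₁ → Space115 L η lev₀ lev₁ Dc₁}
    {F₂ : Space115 L η lev₀ lev₁ Dc₂ → Space115 L η lev₀ lev₁ Dc₂} {F₁' : Space115 L η lev₀ lev₁ Dc₁ →L[ℂ] Space115 L η lev₀ lev₁ Dc₁}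
    {F₂' : Space115 L η lev₀ lev₁ Dc₂ →L[ℂ] Space115 L η lev₀ lev₁ Dc₂} {P : Space115 L η lev₀ lev₁ Dc₁} (h₁ : HasFDerivAt F₁ F₁' P)
    (h₂ : HasFDerivAt F₂ F₂' ((LinearMap.toContinuousLinearMap ((jetLinearEquiv L η lev₀ lev₁ Dc₂).symm.toLinearMap ∘ₗ (jetLinearEquiv L η lev₀ lev₁ Dc₁).toLinearMap)) P)) :
    HasFDerivAt (fun Q : Space115 L η lev₀ lev₁ Dc₂ => (LinearMap.toContinuousLinearMap ((jetLinearEquiv L η lev₀ lev₁ Dc₂).symm.toLinearMap ∘ₗ (jetLinearEquiv L η lev₀ lev₁ Dc₁).toLinearMap)) (F₁ ((LinearMap.toContinuousLinearMap ((jetLinearEquiv L η lev₀ lev₁ Dc₁).symm.toLinearMap ∘ₗ (jetLinearEquiv L η lev₀ lev₁ Dc₂).toLinearMap)) Q)) - F₂ Q) ((LinearMap.toContinuousLinearMap ((jetLinearEquiv L η lev₀ lev₁ Dc₂).symm.toLinearMap ∘ₗ (jetLinearEquiv L η lev₀ lev₁ Dc₁).toLinearMap)).comp (F₁'.comp (LinearMap.toContinuousLinearMap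 ((jetLinearEquiv L η lev₀ lev₁ Dc₁).symm.toLinearMap ∘ₗ (jetLinearEquiv L η lev₀ lev₁ Dc₂).toLinearMap))) - F₂') ((LinearMap.toContinuousLinearMap ((jetLinearEquiv L η lev₀ lev₁ Dc₂).symm.toLinearMap ∘ₗ (jetLinearEquiv L η lev₀ lev₁ Dc₁).toLinearMap)) P) :=
  (hasFDerivAt_conj h₁).sub h₂

/-- The conjugated difference is holomorphic on `‖Q‖ < S` when `F₂` is, `F₁` is holomorphic on `‖x‖ < S₁`, and `ι⁻¹` maps the first ball into the
second (`‖ι⁻¹Q‖ ≤ K_ι‖Q‖`, `K_ιS ≤ S₁`, `K_ι > 0`). [folklore] [cite: Balaban1985Variational, Prop. 6 (117) p.295] -/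
theorem differentiableOn_conj_sub {F₁ : Space115 L η lev₀ lev₁ Dc₁ → Space115 L η lev₀ lev₁ Dc₁}
    {F₂ : Space115 L η lev₀ lev₁ Dc₂ → Space115 L η lev₀ lev₁ Dc₂} {S S₁ Kι : ℝ} (hKι : 0 < Kι)
    (hι : ∀ Q : Space115 L η lev₀ lev₁ Dc₂, ‖(LinearMap.toContinuousLinearMap ((jetLinearEquiv L η lev₀ lev₁ Dc₁).symm.toLinearMap ∘ₗ (jetLinearEquiv L η lev₀ lev₁ Dc₂).toLinearMap)) Q‖ ≤ Kι * ‖Q‖) (hS : Kι * S ≤ S₁)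
    (h₁ : DifferentiableOn ℂ F₁ (ball 0 S₁)) (h₂ : DifferentiableOn ℂ F₂ (ball 0 S)) :
    DifferentiableOn ℂ (fun Q : Space115 L η lev₀ lev₁ Dc₂ => (LinearMap.toContinuousLinearMap ((jetLinearEquiv L η lev₀ lev₁ Dc₂).symm.toLinearMap ∘ₗ (jetLinearEquiv L η lev₀ lev₁ Dc₁).toLinearMap)) (F₁ ((LinearMap.toContinuousLinearMap ((jetLinearEquiv L η lev₀ lev₁ Dc₁).symm.toLinearMap ∘ₗ (jetLinearEquiv L η lev₀ lev₁ Dc₂).toLinearMap)) Q)) - F₂ Q) (ball 0 S) := by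
  refine DifferentiableOn.sub ?_ h₂
  refine (LinearMap.toContinuousLinearMap ((jetLinearEquiv L η lev₀ lev₁ Dc₂).symm.toLinearMap ∘ₗ (jetLinearEquiv L η lev₀ lev₁ Dc₁).toLinearMap)).differentiable.comp_differentiableOn (h₁.comp (LinearMap.toContinuousLinearMap ((jetLinearEquiv L η lev₀ lev₁ Dc₁).symm.toLinearMap ∘ₗ (jetLinearEquiv L η lev₀ lev₁ Dc₂).toLinearMap)).differentiable.differentiableOn fun Q hQ => ?_)
  rw [mem_ball_zero_iff] at hQ ⊢
  exact (hι Q).trans_lt ((mul_lt_mul_of_pos_left hQ hKι).trans_le hS)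

/-- **CAUCHY FOR A CONJUGATED DIFFERENCE**: if `G = ι ∘ F₁ ∘ ι⁻¹ − F₂` is holomorphic on `‖Q‖ < S` with `‖G(Q)‖ ≤ δ` there, and `F₁`, `F₂` are
differentiable at `P`, `ιP` with `‖ιP‖ < S`, then `‖ι ∘L DF₁(P) ∘L ι⁻¹ − DF₂(ιP)‖ ≤ δ/(S − ‖ιP‖)` (`B8SectDSource.norm_fderiv_le_of_norm_le`).
[folklore] [cite: Balaban1985Variational, (53)–(54) p.286, Prop. 6 (120) p.295] -/
theorem norm_conj_fderiv_sub_le {F₁ : Space115 L η lev₀ lev₁ Dc₁ → Space115 L η lev₀ lev₁ Dc₁}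
    {F₂ : Space115 L η lev₀ lev₁ Dc₂ → Space115 L η lev₀ lev₁ Dc₂} {S δ : ℝ} {P : Space115 L η lev₀ lev₁ Dc₁}
    (hG : DifferentiableOn ℂ (fun Q : Space115 L η lev₀ lev₁ Dc₂ => (LinearMap.toContinuousLinearMap ((jetLinearEquiv L η lev₀ lev₁ Dc₂).symm.toLinearMap ∘ₗ (jetLinearEquiv L η lev₀ lev₁ Dc₁).toLinearMap)) (F₁ ((LinearMap.toContinuousLinearMap ((jetLinearEquiv L η lev₀ lev₁ Dc₁).symm.toLinearMap ∘ₗ (jetLinearEquiv L η lev₀ lev₁ Dc₂).toLinearMap)) Q)) - F₂ Q) (ball 0 S))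
    (hδ : ∀ Q ∈ ball (0 : Space115 L η lev₀ lev₁ Dc₂) S, ‖(LinearMap.toContinuousLinearMap ((jetLinearEquiv L η lev₀ lev₁ Dc₂).symm.toLinearMap ∘ₗ (jetLinearEquiv L η lev₀ lev₁ Dc₁).toLinearMap)) (F₁ ((LinearMap.toContinuousLinearMap ((jetLinearEquiv L η lev₀ lev₁ Dc₁).symm.toLinearMap ∘ₗ (jetLinearEquiv L η lev₀ lev₁ Dc₂).toLinearMap)) Q)) - F₂ Q‖ ≤ δ)
    (h₁ : DifferentiableAt ℂ F₁ P) (h₂ : DifferentiableAt ℂ F₂ ((LinearMap.toContinuousLinearMap ((jetLinearEquiv L η lev₀ lev₁ Dc₂).symm.toLinearMap ∘ₗ (jetLinearEquiv L η lev₀ lev₁ Dc₁).toLinearMap)) P)) (hP : ‖(LinearMap.toContinuousLinearMap ((jetLinearEquiv L η lev₀ lev₁ Dc₂).symm.toLinearMap ∘ₗ (jetLinearEquiv L η lev₀ lev₁ Dc₁).toLinearMap)) P‖ < S) :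
    ‖(LinearMap.toContinuousLinearMap ((jetLinearEquiv L η lev₀ lev₁ Dc₂).symm.toLinearMap ∘ₗ (jetLinearEquiv L η lev₀ lev₁ Dc₁).toLinearMap)).comp ((fderiv ℂ F₁ P).comp (LinearMap.toContinuousLinearMap ((jetLinearEquiv L η lev₀ lev₁ Dc₁).symm.toLinearMap ∘ₗ (jetLinearEquiv L η lev₀ lev₁ Dc₂).toLinearMap))) - fderiv ℂ F₂ ((LinearMap.toContinuousLinearMap ((jetLinearEquiv L η lev₀ lev₁ Dc₂).symm.toLinearMap ∘ₗ (jetLinearEquiv L η lev₀ lev₁ Dc₁).toLinearMap)) P)‖ ≤ δ / (S - ‖(LinearMap.toContinuousLinearMap ((jetLinearEquiv L η lev₀ lev₁ Dc₂).symm.toLinearMap ∘ₗ (jetLinearEquiv L η lev₀ lev₁ Dc₁).toLinearMap)) P‖) := by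
  rw [← (hasFDerivAt_conj_sub h₁.hasFDerivAt h₂.hasFDerivAt).fderiv]
  exact B8SectDSource.norm_fderiv_le_of_norm_le hG hδ hP

omit [FiniteDimensional ℂ 𝔸] [Fact (0 < L)] [Fact (0 < η)] [Fintype κ'] in
/-- **AN ENTIRE MAP WITH A (98)-FORM BOUND IS LIPSCHITZ ON THE HALF BALL**: `V` differentiable everywhere, `‖V Y‖ ≤ C_V‖Y‖²` on `‖Y‖ < R_V` ⇒
`‖V Y − V Y′‖ ≤ 2C_VR_V·‖Y − Y′‖` for `‖Y‖, ‖Y′‖ < R_V/2` (Cauchy: `‖DV(Z)‖ ≤ C_VR_V²/(R_V − ‖Z‖) ≤ 2C_VR_V` on the half ball; then the mean-value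
inequality on the convex ball). [folklore] [cite: Balaban1985Variational, Prop. 6 (119)–(120) p.295] -/
theorem norm_sub_le_of_quad_entire {X Z : Type*} [NormedAddCommGroup X] [NormedSpace ℂ X] [NormedAddCommGroup Z] [NormedSpace ℂ Z]
    {V : X → Z} (hV : Differentiable ℂ V) {CV RV : ℝ} (hCV : 0 ≤ CV) (hRV : 0 < RV)
    (hq : ∀ Y : X, ‖Y‖ < RV → ‖V Y‖ ≤ CV * ‖Y‖ ^ 2) {Y Y' : X} (hY : ‖Y‖ < RV / 2) (hY' : ‖Y'‖ < RV / 2) :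
    ‖V Y - V Y'‖ ≤ 2 * CV * RV * ‖Y - Y'‖ := by
  have hb : ∀ Z' ∈ ball (0 : X) (RV / 2), ‖fderiv ℂ V Z'‖ ≤ 2 * CV * RV := by
    intro Z' hZ'
    rw [mem_ball_zero_iff] at hZ'
    have hM : ∀ z ∈ ball (0 : X) RV, ‖V z‖ ≤ CV * RV ^ 2 := fun z hz => by
      have hz' := mem_ball_zero_iff.1 hz
      exact (hq z hz').trans (by gcongr)
    have h := B8SectDSource.norm_fderiv_le_of_norm_le hV.differentiableOn hM (show ‖Z'‖ < RV by linarith)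
    refine h.trans ?_
    rw [div_le_iff₀ (by linarith)]
    nlinarith [mul_nonneg hCV hRV.le, norm_nonneg Z']
  exact (convex_ball (0 : X) (RV / 2)).norm_image_sub_le_of_norm_fderiv_le (𝕜 := ℂ) (fun _ _ => hV.differentiableAt) hb
    (mem_ball_zero_iff.2 hY') (mem_ball_zero_iff.2 hY)

end Calculus

/-! ## §4 The four groups of `W = (δ/δA′)V` at a point, across the two carriers -/

section Groups

variable {ρ : (𝔸 →L[ℂ] ℂ) →L[ℂ] 𝔸} {τ : 𝔸 →L[ℂ] ℂ} {κc : ℝ}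
  {H₁ : 𝒳 →L[ℂ] Space115 L η lev₀ lev₁ Dc₁} {C₁ : Space115 L η lev₀ lev₁ Dc₁ → 𝒳}
  {H₂ : 𝒳 →L[ℂ] Space115 L η lev₀ lev₁ Dc₂} {C₂ : Space115 L η lev₀ lev₁ Dc₂ → 𝒳} {εC₁ εC₂ : ℝ}
  {P : Space115 L η lev₀ lev₁ Dc₁}

/-- **(85) ACROSS THE CARRIERS**: `W₁(…₁)(P) − W₁(…₂)(ιP) = −(ι(HD₃)′₁(P)ι⁻¹ − (HD₃)′₂(ιP))ᵗJ`, so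
`‖W₁(…₁)(P) − W₁(…₂)(ιP)‖₍₋₃₎ ≤ ‖ρ‖‖τ‖κ·g₃·‖J‖₍₋₃₎` for `‖ι ∘L D(HD₃)₁(P) ∘L ι⁻¹ − D(HD₃)₂(ιP)‖ ≤ g₃`.
[cite: Balaban1985Variational, (85)–(86) p.291] -/
theorem norm_W1_sub_W1_le (hκ0 : 0 ≤ κc)
    (hκ : ∀ (N : Space115 L η lev₀ lev₁ Dc₂ →L[ℂ] Space115 L η lev₀ lev₁ Dc₂) (b : Bond d Pd),
      ∑ b' : Bond d Pd, levWeight L η lev₀ 3 b / levWeight L η lev₀ 3 b' * ‖kernel N b' b‖ ≤ κc * ‖N‖)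
    (J : NegSize L η lev₀ 3 𝔸) {g₃ : ℝ}
    (hg₃ : ‖(LinearMap.toContinuousLinearMap ((jetLinearEquiv L η lev₀ lev₁ Dc₂).symm.toLinearMap ∘ₗ (jetLinearEquiv L η lev₀ lev₁ Dc₁).toLinearMap)).comp ((fderiv ℂ (E3 H₁ C₁ εC₁) P).comp (LinearMap.toContinuousLinearMap ((jetLinearEquiv L η lev₀ lev₁ Dc₁).symm.toLinearMap ∘ₗ (jetLinearEquiv L η lev₀ lev₁ Dc₂).toLinearMap))) - fderiv ℂ (E3 H₂ C₂ εC₂) ((LinearMap.toContinuousLinearMap ((jetLinearEquiv L η lev₀ lev₁ Dc₂).symm.toLinearMap ∘ₗ (jetLinearEquiv L η lev₀ lev₁ Dc₁).toLinearMap)) P)‖ ≤ g₃) :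
    ‖W1 ρ τ H₁ C₁ εC₁ J P - W1 ρ τ H₂ C₂ εC₂ J ((LinearMap.toContinuousLinearMap ((jetLinearEquiv L η lev₀ lev₁ Dc₂).symm.toLinearMap ∘ₗ (jetLinearEquiv L η lev₀ lev₁ Dc₁).toLinearMap)) P)‖ ≤ ‖ρ‖ * ‖τ‖ * κc * (g₃ * ‖J‖) := by
  have e : W1 ρ τ H₁ C₁ εC₁ J P - W1 ρ τ H₂ C₂ εC₂ J ((LinearMap.toContinuousLinearMap ((jetLinearEquiv L η lev₀ lev₁ Dc₂).symm.toLinearMap ∘ₗ (jetLinearEquiv L η lev₀ lev₁ Dc₁).toLinearMap)) P) =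
      -(transCur ρ τ ((LinearMap.toContinuousLinearMap ((jetLinearEquiv L η lev₀ lev₁ Dc₂).symm.toLinearMap ∘ₗ (jetLinearEquiv L η lev₀ lev₁ Dc₁).toLinearMap)).comp ((fderiv ℂ (E3 H₁ C₁ εC₁) P).comp (LinearMap.toContinuousLinearMap ((jetLinearEquiv L η lev₀ lev₁ Dc₁).symm.toLinearMap ∘ₗ (jetLinearEquiv L η lev₀ lev₁ Dc₂).toLinearMap)))) J - transCur ρ τ (fderiv ℂ (E3 H₂ C₂ εC₂) ((LinearMap.toContinuousLinearMap ((jetLinearEquiv L η lev₀ lev₁ Dc₂).symm.toLinearMap ∘ₗ (jetLinearEquiv L η lev₀ lev₁ Dc₁).toLinearMap)) P)) J) := by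
    rw [W1, W1, transCur_conj]; abel
  rw [e, norm_neg]
  have h := norm_transCur_sub_transCur_le ρ τ hκ0 hκ _ _ J J hg₃ le_rfl le_rfl (show ‖J - J‖ ≤ 0 by rw [sub_self, norm_zero])
  refine h.trans (le_of_eq ?_)
  ring

/-- **(87)–(88) ACROSS THE CARRIERS**: `W₂(…₁)(P) − W₂(…₂)(ιP) = −[(Δ_π₁(HD₁P) − Δ_π₂(HD₂(ιP))) + ((ιHD′₁ι⁻¹)ᵗ(Δ_π₁P) − (HD′₂)ᵗ(Δ_π₂(ιP)))]`, so
with `‖ι ∘L D(HD)₁(P) ∘L ι⁻¹ − D(HD)₂(ιP)‖ ≤ g_E`, `‖D(HD)₂(ιP)‖ ≤ d_E`, `‖Δ_π₁(HD₁P) − Δ_π₂(HD₂(ιP))‖ ≤ b_Δ`, `‖Δ_π₁P‖ ≤ n_Δ`, `‖Δ_π₁P − Δ_π₂(ιP)‖ ≤ a_Δ`: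
`‖W₂(…₁)(P) − W₂(…₂)(ιP)‖₍₋₃₎ ≤ b_Δ + ‖ρ‖‖τ‖κ·(g_E·n_Δ + d_E·a_Δ)`. [cite: Balaban1985Variational, (87)–(88) p.291] -/
theorem norm_W2_sub_W2_le (hκ0 : 0 ≤ κc)
    (hκ : ∀ (N : Space115 L η lev₀ lev₁ Dc₂ →L[ℂ] Space115 L η lev₀ lev₁ Dc₂) (b : Bond d Pd),
      ∑ b' : Bond d Pd, levWeight L η lev₀ 3 b / levWeight L η lev₀ 3 b' * ‖kernel N b' b‖ ≤ κc * ‖N‖)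
    (Δπ₁ : Space115 L η lev₀ lev₁ Dc₁ →L[ℂ] NegSize L η lev₀ 3 𝔸) (Δπ₂ : Space115 L η lev₀ lev₁ Dc₂ →L[ℂ] NegSize L η lev₀ 3 𝔸)
    {gE dE bΔ nΔ aΔ : ℝ}
    (hgE : ‖(LinearMap.toContinuousLinearMap ((jetLinearEquiv L η lev₀ lev₁ Dc₂).symm.toLinearMap ∘ₗ (jetLinearEquiv L η lev₀ lev₁ Dc₁).toLinearMap)).comp ((fderiv ℂ (Emap H₁ C₁ εC₁) P).comp (LinearMap.toContinuousLinearMap ((jetLinearEquiv L η lev₀ lev₁ Dc₁).symm.toLinearMap ∘ₗ (jetLinearEquiv L η lev₀ lev₁ Dc₂).toLinearMap))) - fderiv ℂ (Emap H₂ C₂ εC₂) ((LinearMap.toContinuousLinearMap ((jetLinearEquiv L η lev₀ lev₁ Dc₂).symm.toLinearMap ∘ₗ (jetLinearEquiv L η lev₀ lev₁ Dc₁).toLinearMap)) P)‖ ≤ gE)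
    (hdE : ‖fderiv ℂ (Emap H₂ C₂ εC₂) ((LinearMap.toContinuousLinearMap ((jetLinearEquiv L η lev₀ lev₁ Dc₂).symm.toLinearMap ∘ₗ (jetLinearEquiv L η lev₀ lev₁ Dc₁).toLinearMap)) P)‖ ≤ dE)
    (hbΔ : ‖Δπ₁ (Emap H₁ C₁ εC₁ P) - Δπ₂ (Emap H₂ C₂ εC₂ ((LinearMap.toContinuousLinearMap ((jetLinearEquiv L η lev₀ lev₁ Dc₂).symm.toLinearMap ∘ₗ (jetLinearEquiv L η lev₀ lev₁ Dc₁).toLinearMap)) P))‖ ≤ bΔ) (hnΔ : ‖Δπ₁ P‖ ≤ nΔ)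
    (haΔ : ‖Δπ₁ P - Δπ₂ ((LinearMap.toContinuousLinearMap ((jetLinearEquiv L η lev₀ lev₁ Dc₂).symm.toLinearMap ∘ₗ (jetLinearEquiv L η lev₀ lev₁ Dc₁).toLinearMap)) P)‖ ≤ aΔ) :
    ‖W2 ρ τ H₁ C₁ εC₁ Δπ₁ P - W2 ρ τ H₂ C₂ εC₂ Δπ₂ ((LinearMap.toContinuousLinearMap ((jetLinearEquiv L η lev₀ lev₁ Dc₂).symm.toLinearMap ∘ₗ (jetLinearEquiv L η lev₀ lev₁ Dc₁).toLinearMap)) P)‖ ≤ bΔ + ‖ρ‖ * ‖τ‖ * κc * (gE * nΔ + dE * aΔ) := by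
  have e : W2 ρ τ H₁ C₁ εC₁ Δπ₁ P - W2 ρ τ H₂ C₂ εC₂ Δπ₂ ((LinearMap.toContinuousLinearMap ((jetLinearEquiv L η lev₀ lev₁ Dc₂).symm.toLinearMap ∘ₗ (jetLinearEquiv L η lev₀ lev₁ Dc₁).toLinearMap)) P) =
      -((Δπ₁ (Emap H₁ C₁ εC₁ P) - Δπ₂ (Emap H₂ C₂ εC₂ ((LinearMap.toContinuousLinearMap ((jetLinearEquiv L η lev₀ lev₁ Dc₂).symm.toLinearMap ∘ₗ (jetLinearEquiv L η lev₀ lev₁ Dc₁).toLinearMap)) P))) +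
        (transCur ρ τ ((LinearMap.toContinuousLinearMap ((jetLinearEquiv L η lev₀ lev₁ Dc₂).symm.toLinearMap ∘ₗ (jetLinearEquiv L η lev₀ lev₁ Dc₁).toLinearMap)).comp ((fderiv ℂ (Emap H₁ C₁ εC₁) P).comp (LinearMap.toContinuousLinearMap ((jetLinearEquiv L η lev₀ lev₁ Dc₁).symm.toLinearMap ∘ₗ (jetLinearEquiv L η lev₀ lev₁ Dc₂).toLinearMap)))) (Δπ₁ P) -
          transCur ρ τ (fderiv ℂ (Emap H₂ C₂ εC₂) ((LinearMap.toContinuousLinearMap ((jetLinearEquiv L η lev₀ lev₁ Dc₂).symm.toLinearMap ∘ₗ (jetLinearEquiv L η lev₀ lev₁ Dc₁).toLinearMap)) P)) (Δπ₂ ((LinearMap.toContinuousLinearMap ((jetLinearEquiv L η lev₀ lev₁ Dc₂).symm.toLinearMap ∘ₗ (jetLinearEquiv L η lev₀ lev₁ Dc₁).toLinearMap)) P)))) := by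
    rw [W2, W2, transCur_conj]; abel
  rw [e, norm_neg]
  refine (norm_add_le _ _).trans (add_le_add hbΔ ?_)
  exact norm_transCur_sub_transCur_le ρ τ hκ0 hκ _ _ _ _ hgE hdE hnΔ haΔ

/-- **(89) ACROSS THE CARRIERS**: `W₃(…₁)(P) − W₃(…₂)(ιP) = (ιHD′₁ι⁻¹)ᵗ(Δ_π₁(HD₁P)) − (HD′₂)ᵗ(Δ_π₂(HD₂(ιP)))`, so with the letters of `norm_W2_sub_W2_le` and
`‖Δ_π₁(HD₁P)‖ ≤ m_Δ`: `‖W₃(…₁)(P) − W₃(…₂)(ιP)‖₍₋₃₎ ≤ ‖ρ‖‖τ‖κ·(g_E·m_Δ + d_E·b_Δ)`. [cite: Balaban1985Variational, (89) p.291] -/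
theorem norm_W3_sub_W3_le (hκ0 : 0 ≤ κc)
    (hκ : ∀ (N : Space115 L η lev₀ lev₁ Dc₂ →L[ℂ] Space115 L η lev₀ lev₁ Dc₂) (b : Bond d Pd),
      ∑ b' : Bond d Pd, levWeight L η lev₀ 3 b / levWeight L η lev₀ 3 b' * ‖kernel N b' b‖ ≤ κc * ‖N‖)
    (Δπ₁ : Space115 L η lev₀ lev₁ Dc₁ →L[ℂ] NegSize L η lev₀ 3 𝔸) (Δπ₂ : Space115 L η lev₀ lev₁ Dc₂ →L[ℂ] NegSize L η lev₀ 3 𝔸)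
    {gE dE bΔ mΔ : ℝ}
    (hgE : ‖(LinearMap.toContinuousLinearMap ((jetLinearEquiv L η lev₀ lev₁ Dc₂).symm.toLinearMap ∘ₗ (jetLinearEquiv L η lev₀ lev₁ Dc₁).toLinearMap)).comp ((fderiv ℂ (Emap H₁ C₁ εC₁) P).comp (LinearMap.toContinuousLinearMap ((jetLinearEquiv L η lev₀ lev₁ Dc₁).symm.toLinearMap ∘ₗ (jetLinearEquiv L η lev₀ lev₁ Dc₂).toLinearMap))) - fderiv ℂ (Emap H₂ C₂ εC₂) ((LinearMap.toContinuousLinearMap ((jetLinearEquiv L η lev₀ lev₁ Dc₂).symm.toLinearMap ∘ₗ (jetLinearEquiv L η lev₀ lev₁ Dc₁).toLinearMap)) P)‖ ≤ gE)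
    (hdE : ‖fderiv ℂ (Emap H₂ C₂ εC₂) ((LinearMap.toContinuousLinearMap ((jetLinearEquiv L η lev₀ lev₁ Dc₂).symm.toLinearMap ∘ₗ (jetLinearEquiv L η lev₀ lev₁ Dc₁).toLinearMap)) P)‖ ≤ dE)
    (hbΔ : ‖Δπ₁ (Emap H₁ C₁ εC₁ P) - Δπ₂ (Emap H₂ C₂ εC₂ ((LinearMap.toContinuousLinearMap ((jetLinearEquiv L η lev₀ lev₁ Dc₂).symm.toLinearMap ∘ₗ (jetLinearEquiv L η lev₀ lev₁ Dc₁).toLinearMap)) P))‖ ≤ bΔ) (hmΔ : ‖Δπ₁ (Emap H₁ C₁ εC₁ P)‖ ≤ mΔ) :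
    ‖W3 ρ τ H₁ C₁ εC₁ Δπ₁ P - W3 ρ τ H₂ C₂ εC₂ Δπ₂ ((LinearMap.toContinuousLinearMap ((jetLinearEquiv L η lev₀ lev₁ Dc₂).symm.toLinearMap ∘ₗ (jetLinearEquiv L η lev₀ lev₁ Dc₁).toLinearMap)) P)‖ ≤ ‖ρ‖ * ‖τ‖ * κc * (gE * mΔ + dE * bΔ) := by
  have e : W3 ρ τ H₁ C₁ εC₁ Δπ₁ P - W3 ρ τ H₂ C₂ εC₂ Δπ₂ ((LinearMap.toContinuousLinearMap ((jetLinearEquiv L η lev₀ lev₁ Dc₂).symm.toLinearMap ∘ₗ (jetLinearEquiv L η lev₀ lev₁ Dc₁).toLinearMap)) P) =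
      transCur ρ τ ((LinearMap.toContinuousLinearMap ((jetLinearEquiv L η lev₀ lev₁ Dc₂).symm.toLinearMap ∘ₗ (jetLinearEquiv L η lev₀ lev₁ Dc₁).toLinearMap)).comp ((fderiv ℂ (Emap H₁ C₁ εC₁) P).comp (LinearMap.toContinuousLinearMap ((jetLinearEquiv L η lev₀ lev₁ Dc₁).symm.toLinearMap ∘ₗ (jetLinearEquiv L η lev₀ lev₁ Dc₂).toLinearMap)))) (Δπ₁ (Emap H₁ C₁ εC₁ P)) -
        transCur ρ τ (fderiv ℂ (Emap H₂ C₂ εC₂) ((LinearMap.toContinuousLinearMap ((jetLinearEquiv L η lev₀ lev₁ Dc₂).symm.toLinearMap ∘ₗ (jetLinearEquiv L η lev₀ lev₁ Dc₁).toLinearMap)) P)) (Δπ₂ (Emap H₂ C₂ εC₂ ((LinearMap.toContinuousLinearMap ((jetLinearEquiv L η lev₀ lev₁ Dc₂).symm.toLinearMap ∘ₗ (jetLinearEquiv L η lev₀ lev₁ Dc₁).toLinearMap)) P))) := by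
    rw [W3, W3, transCur_conj]
  rw [e]
  exact norm_transCur_sub_transCur_le ρ τ hκ0 hκ _ _ _ _ hgE hdE hmΔ hbΔ

/-- **(90)–(96) ACROSS THE CARRIERS**: the composed V₀-group `(T′(A′))ᵗ curV0(T A′)` (`curV0full`): with `‖ι ∘L DT₁(P) ∘L ι⁻¹ − DT₂(ιP)‖ ≤ g_T`,
`‖DT₂(ιP)‖ ≤ d_T`, `‖curV0₁(T₁P)‖ ≤ n_V`, `‖curV0₁(T₁P) − curV0₂(T₂(ιP))‖ ≤ b_V`:
`‖curV0full(…₁)(P) − curV0full(…₂)(ιP)‖₍₋₃₎ ≤ ‖ρ‖‖τ‖κ·(g_T·n_V + d_T·b_V)`. [cite: Balaban1985Variational, (90) p.291, (91)–(96) p.292] -/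
theorem norm_curV0full_sub_curV0full_le (hκ0 : 0 ≤ κc)
    (hκ : ∀ (N : Space115 L η lev₀ lev₁ Dc₂ →L[ℂ] Space115 L η lev₀ lev₁ Dc₂) (b : Bond d Pd),
      ∑ b' : Bond d Pd, levWeight L η lev₀ 3 b / levWeight L η lev₀ 3 b' * ‖kernel N b' b‖ ≤ κc * ‖N‖)
    (U₁ U₂ : Bond d Pd → 𝔸ˣ) {gT dT nV bV : ℝ}
    (hgT : ‖(LinearMap.toContinuousLinearMap ((jetLinearEquiv L η lev₀ lev₁ Dc₂).symm.toLinearMap ∘ₗ (jetLinearEquiv L η lev₀ lev₁ Dc₁).toLinearMap)).comp ((fderiv ℂ (T47 H₁ C₁ εC₁) P).comp (LinearMap.toContinuousLinearMap ((jetLinearEquiv L η lev₀ lev₁ Dc₁).symm.toLinearMap ∘ₗ (jetLinearEquiv L η lev₀ lev₁ Dc₂).toLinearMap))) - fderiv ℂ (T47 H₂ C₂ εC₂) ((LinearMap.toContinuousLinearMap ((jetLinearEquiv L η lev₀ lev₁ Dc₂).symm.toLinearMap ∘ₗ (jetLinearEquiv L η lev₀ lev₁ Dc₁).toLinearMap))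 P)‖ ≤ gT)
    (hdT : ‖fderiv ℂ (T47 H₂ C₂ εC₂) ((LinearMap.toContinuousLinearMap ((jetLinearEquiv L η lev₀ lev₁ Dc₂).symm.toLinearMap ∘ₗ (jetLinearEquiv L η lev₀ lev₁ Dc₁).toLinearMap)) P)‖ ≤ dT)
    (hnV : ‖curV0 (lev₁ := lev₁) (Dc := Dc₁) ρ τ U₁ (T47 H₁ C₁ εC₁ P)‖ ≤ nV)
    (hbV : ‖curV0 (lev₁ := lev₁) (Dc := Dc₁) ρ τ U₁ (T47 H₁ C₁ εC₁ P) -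
      curV0 (lev₁ := lev₁) (Dc := Dc₂) ρ τ U₂ (T47 H₂ C₂ εC₂ ((LinearMap.toContinuousLinearMap ((jetLinearEquiv L η lev₀ lev₁ Dc₂).symm.toLinearMap ∘ₗ (jetLinearEquiv L η lev₀ lev₁ Dc₁).toLinearMap)) P))‖ ≤ bV) :
    ‖curV0full ρ τ U₁ H₁ C₁ εC₁ P - curV0full ρ τ U₂ H₂ C₂ εC₂ ((LinearMap.toContinuousLinearMap ((jetLinearEquiv L η lev₀ lev₁ Dc₂).symm.toLinearMap ∘ₗ (jetLinearEquiv L η lev₀ lev₁ Dc₁).toLinearMap)) P)‖ ≤ ‖ρ‖ * ‖τ‖ * κc * (gT * nV + dT * bV) := by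
  have e : curV0full ρ τ U₁ H₁ C₁ εC₁ P - curV0full ρ τ U₂ H₂ C₂ εC₂ ((LinearMap.toContinuousLinearMap ((jetLinearEquiv L η lev₀ lev₁ Dc₂).symm.toLinearMap ∘ₗ (jetLinearEquiv L η lev₀ lev₁ Dc₁).toLinearMap)) P) =
      transCur ρ τ ((LinearMap.toContinuousLinearMap ((jetLinearEquiv L η lev₀ lev₁ Dc₂).symm.toLinearMap ∘ₗ (jetLinearEquiv L η lev₀ lev₁ Dc₁).toLinearMap)).comp ((fderiv ℂ (T47 H₁ C₁ εC₁) P).comp (LinearMap.toContinuousLinearMap ((jetLinearEquiv L η lev₀ lev₁ Dc₁).symm.toLinearMap ∘ₗ (jetLinearEquiv L η lev₀ lev₁ Dc₂).toLinearMap))))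
          (curV0 (lev₁ := lev₁) (Dc := Dc₁) ρ τ U₁ (T47 H₁ C₁ εC₁ P)) -
        transCur ρ τ (fderiv ℂ (T47 H₂ C₂ εC₂) ((LinearMap.toContinuousLinearMap ((jetLinearEquiv L η lev₀ lev₁ Dc₂).symm.toLinearMap ∘ₗ (jetLinearEquiv L η lev₀ lev₁ Dc₁).toLinearMap)) P)) (curV0 (lev₁ := lev₁) (Dc := Dc₂) ρ τ U₂ (T47 H₂ C₂ εC₂ ((LinearMap.toContinuousLinearMap ((jetLinearEquiv L η lev₀ lev₁ Dc₂).symm.toLinearMap ∘ₗ (jetLinearEquiv L η lev₀ lev₁ Dc₁).toLinearMap)) P))) := by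
    rw [curV0full_apply, curV0full_apply, transCur_conj]
  rw [e]
  exact norm_transCur_sub_transCur_le ρ τ hκ0 hκ _ _ _ _ hgT hdT hnV hbV

/-- **THE FOUR GROUPS SUMMED**: `W = W₁ + W₂ + W₃ + curV0full` (`B11Eq80Current.W80`), so the difference of `W` at the two carriers is bounded by the
sum of the four group bounds. [cite: Balaban1985Variational, (84) p.290, (85)–(96) pp.291–292] -/
theorem norm_W80_sub_W80_le_of_groups (U₁ U₂ : Bond d Pd → 𝔸ˣ) (J : NegSize L η lev₀ 3 𝔸)
    (Δπ₁ : Space115 L η lev₀ lev₁ Dc₁ →L[ℂ] NegSize L η lev₀ 3 𝔸) (Δπ₂ : Space115 L η lev₀ lev₁ Dc₂ →L[ℂ] NegSize L η lev₀ 3 𝔸)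
    {w₁ w₂ w₃ w₄ : ℝ} (h₁ : ‖W1 ρ τ H₁ C₁ εC₁ J P - W1 ρ τ H₂ C₂ εC₂ J ((LinearMap.toContinuousLinearMap ((jetLinearEquiv L η lev₀ lev₁ Dc₂).symm.toLinearMap ∘ₗ (jetLinearEquiv L η lev₀ lev₁ Dc₁).toLinearMap)) P)‖ ≤ w₁)
    (h₂ : ‖W2 ρ τ H₁ C₁ εC₁ Δπ₁ P - W2 ρ τ H₂ C₂ εC₂ Δπ₂ ((LinearMap.toContinuousLinearMap ((jetLinearEquiv L η lev₀ lev₁ Dc₂).symm.toLinearMap ∘ₗ (jetLinearEquiv L η lev₀ lev₁ Dc₁).toLinearMap)) P)‖ ≤ w₂)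
    (h₃ : ‖W3 ρ τ H₁ C₁ εC₁ Δπ₁ P - W3 ρ τ H₂ C₂ εC₂ Δπ₂ ((LinearMap.toContinuousLinearMap ((jetLinearEquiv L η lev₀ lev₁ Dc₂).symm.toLinearMap ∘ₗ (jetLinearEquiv L η lev₀ lev₁ Dc₁).toLinearMap)) P)‖ ≤ w₃)
    (h₄ : ‖curV0full ρ τ U₁ H₁ C₁ εC₁ P - curV0full ρ τ U₂ H₂ C₂ εC₂ ((LinearMap.toContinuousLinearMap ((jetLinearEquiv L η lev₀ lev₁ Dc₂).symm.toLinearMap ∘ₗ (jetLinearEquiv L η lev₀ lev₁ Dc₁).toLinearMap)) P)‖ ≤ w₄) :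
    ‖W80 ρ τ U₁ H₁ C₁ εC₁ J Δπ₁ P - W80 ρ τ U₂ H₂ C₂ εC₂ J Δπ₂ ((LinearMap.toContinuousLinearMap ((jetLinearEquiv L η lev₀ lev₁ Dc₂).symm.toLinearMap ∘ₗ (jetLinearEquiv L η lev₀ lev₁ Dc₁).toLinearMap)) P)‖ ≤ w₁ + w₂ + w₃ + w₄ := by
  have e : W80 ρ τ U₁ H₁ C₁ εC₁ J Δπ₁ P - W80 ρ τ U₂ H₂ C₂ εC₂ J Δπ₂ ((LinearMap.toContinuousLinearMap ((jetLinearEquiv L η lev₀ lev₁ Dc₂).symm.toLinearMap ∘ₗ (jetLinearEquiv L η lev₀ lev₁ Dc₁).toLinearMap)) P) =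
      (W1 ρ τ H₁ C₁ εC₁ J P - W1 ρ τ H₂ C₂ εC₂ J ((LinearMap.toContinuousLinearMap ((jetLinearEquiv L η lev₀ lev₁ Dc₂).symm.toLinearMap ∘ₗ (jetLinearEquiv L η lev₀ lev₁ Dc₁).toLinearMap)) P)) + (W2 ρ τ H₁ C₁ εC₁ Δπ₁ P - W2 ρ τ H₂ C₂ εC₂ Δπ₂ ((LinearMap.toContinuousLinearMap ((jetLinearEquiv L η lev₀ lev₁ Dc₂).symm.toLinearMap ∘ₗ (jetLinearEquiv L η lev₀ lev₁ Dc₁).toLinearMap)) P)) +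
        (W3 ρ τ H₁ C₁ εC₁ Δπ₁ P - W3 ρ τ H₂ C₂ εC₂ Δπ₂ ((LinearMap.toContinuousLinearMap ((jetLinearEquiv L η lev₀ lev₁ Dc₂).symm.toLinearMap ∘ₗ (jetLinearEquiv L η lev₀ lev₁ Dc₁).toLinearMap)) P)) +
          (curV0full ρ τ U₁ H₁ C₁ εC₁ P - curV0full ρ τ U₂ H₂ C₂ εC₂ ((LinearMap.toContinuousLinearMap ((jetLinearEquiv L η lev₀ lev₁ Dc₂).symm.toLinearMap ∘ₗ (jetLinearEquiv L η lev₀ lev₁ Dc₁).toLinearMap)) P)) := by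
    rw [W80, W80]; abel
  rw [e]
  exact (norm_add_le _ _).trans (add_le_add ((norm_add_le _ _).trans (add_le_add ((norm_add_le _ _).trans (add_le_add h₁ h₂)) h₃)) h₄)

end Groups

end Literature.MathematicalPhysics.QuantumFieldTheory.Balaban1983to89.B11Eq80CurrentTwoCarriers

end
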